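import Summits.Ventures.LatticeQCDFlow.Scoring.OnePlaquetteSU3Bessel
import HarnessLib

/-!
# The SU(3) one-plaquette PLAQUETTE in Bessel form: `⟨(1/3) Re tr U_p⟩_β` as a ratio of Bessel–Toeplitz series

HONEST FRAMING: exact (Metropolis-corrected) sampling algorithms for lattice gauge theory;
figures of merit are autocorrelation/cost numbers at stated couplings and volumes; no
continuum-physics claim.

Venture `LatticeQCDFlow` (cell pub-lqcd), sub-topic `Scoring`; FANOUT row 5 (`s0-sun-a`, S0-C
implementation A — the 'exact 2-d plaquette oracle' column), GEN-16.  NEW WORK of the cell (placement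
rule); companion of `Scoring/OnePlaquetteSU3Bessel.lean` (`Z₃(β) = 6(2π)² Σ_q det[I_{|q+i−j|}(β/3)]`).
The same route — the maximal torus of `SU(3)` as a two-link / three-plaquette abelian complex, GEN-7's
character expansion, and a per-charge determinant identity — gives the NUMERATOR of the plaquette
expectation and hence GEN-6's Weyl-torus SU(3) plaquette `onePlaquetteExpectSU3 β plaqSU3` (the
object of the `β = 4, 5, 6` kernel enclosures of `OnePlaquetteSU3Enclosures`) in closed Bessel form:

* §1 `ofReal_reTrSU3_eq_sum` — `Re tr U = ½ Σ_{j<6} e^{i(d_jθ₁ + d'_jθ₂)}` over the six shifts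
  `(d, d') = (±1, 0), (0, ±1), ±(1, 1)`; `plaqSU3_mul_weylSU3_eq_sum` —
  `(1/3) Re tr U · |Δ|² = (1/6) Σ_{v<19} Σ_{j<6} c_v e^{i((a_v+d_j)θ₁ + (b_v+d'_j)θ₂)}`;
* §2 `integral2_plaqSU3_numerator_eq_sum_modes` — the numerator by modes,
  `(1/6) Σ_{v,j} c_v (2π)² Σ_q I_{|q+a_v+d_j|} I_{|q+b_v+d'_j|} I_{|q|}`;
* §3 **`su3_fourier_toeplitz_identity_plaq`** — the per-charge identity: shifting the `(v,j)` mode by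
  `−⌊(a+b+1)/3⌋` (its third eigen-angle exponent), the `114` signed triple products sum, for every
  `q`, to `3! Σ_{l<3} (det[I_{|q+i−j+[j=l]|}] + det[I_{|q+i−j−[j=l]|}])` — the Toeplitz determinant with
  its `l`-th column shifted up and down (`e^{±iθ_k}` multiplies the `k`-th eigenvalue; after
  `k ↦ τ⁻¹k` the shifted position is the column `l = τ(k)`); checked by `ring`;
* §4 **`integral2_plaqSU3_numerator_eq_tsum_det`** —
  `∫∫ (1/3) Re tr U |Δ|² e^{(β/3) Re tr U} = (2π)² Σ_{q ∈ ℤ} Σ_{l<3} (det M⁺_{q,l} + det M⁻_{q,l})`,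
  and **`onePlaquetteExpectSU3_plaqSU3_eq_tsum_det`** — THE PLAQUETTE
  `⟨(1/3) Re tr U_p⟩_β = Σ_q Σ_l (det M⁺_{q,l} + det M⁻_{q,l}) / (6 Σ_q det M_q)`,
  `M_q = [I_{|q+i−j|}(β/3)]_{i,j<3}`, `M^±_{q,l}` = `M_q` with `±1` added to the order in column `l`.

Since `I_n'(c) = (I_{n−1}(c) + I_{n+1}(c))/2`, `Σ_l (det M⁺_{q,l} + det M⁻_{q,l}) = 2 (d/dc) det M_q(c)`
and the plaquette is `(d/dβ) log Z₃(β)` — the form in which the strong-coupling literature states it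
(R. C. Brower, P. Rossi, C.-I. Tan, Nucl. Phys. B 190 (1981) 699; A. B. Balantekin, Phys. Rev. D 62
(2000) 085017); that derivative identification is NOT typed here (no derivative of the tree's
`besselI` is used).  All series converge absolutely (`summable_besselI_triple`); numerically (not a
theorem) the `|q| ≤ 6` truncations reproduce GEN-6's three enclosures `0.279619149409…`,
`0.353954436705…`, `0.422531739649…` (`β = 4, 5, 6`) to twelve digits.  Nothing is cited as a
fact; no `def`.
-/

noncomputable section

open scoped Nat
open Real MeasureTheory Set Finset Literature.Analysis.FunctionSpaces

namespace Summit.Ventures.LatticeQCDFlow.Scoring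

/-! ### 1. `Re tr U` and `(1/3) Re tr U · |Δ|²` in Fourier modes -/

/-- `Re tr U = ½ Σ_{j<6} e^{i(d_j θ₁ + d'_j θ₂)}` over the six shifts
`(d, d') = (±1,0), (0,±1), ±(1,1)` (`cos θ₁`, `cos θ₂`, `cos(θ₁+θ₂)`). -/
theorem ofReal_reTrSU3_eq_sum (θ₁ θ₂ : ℝ) :
    (reTrSU3 θ₁ θ₂ : ℂ) = (1 / 2 : ℂ) * ∑ j : Fin 6,
      torusMode ((![1, -1, 0, 0, 1, -1] : Fin 6 → ℤ) j) ((![0, 0, 1, -1, 1, -1] : Fin 6 → ℤ) j)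
        θ₁ θ₂ := by
  have hu : Complex.exp ((θ₁ : ℂ) * Complex.I) ≠ 0 := Complex.exp_ne_zero _
  have hw : Complex.exp ((θ₂ : ℂ) * Complex.I) ≠ 0 := Complex.exp_ne_zero _
  have e12 : Complex.exp (((θ₁ : ℂ) + (θ₂ : ℂ)) * Complex.I)
      = Complex.exp ((θ₁ : ℂ) * Complex.I) * Complex.exp ((θ₂ : ℂ) * Complex.I) := by
    rw [add_mul, Complex.exp_add]
  simp only [reTrSU3, Complex.ofReal_add, ofReal_cos_eq, e12, Fin.sum_univ_succ, Fin.sum_univ_zero,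
    Matrix.cons_val_zero, Matrix.cons_val_succ, torusMode_eq_zpow, zpow_one, zpow_zero, zpow_neg,
    Int.reduceNeg, mul_one, one_mul]
  field_simp
  ring

/-- **`(1/3) Re tr U · |Δ|²` in Fourier modes**:
`= (1/6) Σ_{v<19} Σ_{j<6} c_v e^{i((a_v+d_j)θ₁ + (b_v+d'_j)θ₂)}`. -/
theorem plaqSU3_mul_weylSU3_eq_sum (θ₁ θ₂ : ℝ) :
    (plaqSU3 θ₁ θ₂ : ℂ) * (weylSU3 θ₁ θ₂ : ℂ) = (1 / 6 : ℂ) * ∑ v ∈ range 19, ∑ j : Fin 6,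
      (su3wC v : ℂ) * torusMode (su3wA v + (![1, -1, 0, 0, 1, -1] : Fin 6 → ℤ) j)
        (su3wB v + (![0, 0, 1, -1, 1, -1] : Fin 6 → ℤ) j) θ₁ θ₂ := by
  have hmode : ∀ (v : ℕ) (j : Fin 6),
      (su3wC v : ℂ) * torusMode (su3wA v + (![1, -1, 0, 0, 1, -1] : Fin 6 → ℤ) j)
        (su3wB v + (![0, 0, 1, -1, 1, -1] : Fin 6 → ℤ) j) θ₁ θ₂
      = torusMode ((![1, -1, 0, 0, 1, -1] : Fin 6 → ℤ) j) ((![0, 0, 1, -1, 1, -1] : Fin 6 → ℤ) j)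
          θ₁ θ₂ * ((su3wC v : ℂ) * torusMode (su3wA v) (su3wB v) θ₁ θ₂) := by
    intro v j
    rw [mul_left_comm, torusMode_mul, add_comm ((![1, -1, 0, 0, 1, -1] : Fin 6 → ℤ) j),
      add_comm ((![0, 0, 1, -1, 1, -1] : Fin 6 → ℤ) j)]
  simp_rw [hmode]
  rw [Finset.sum_comm, ← Finset.sum_mul_sum, ← weylSU3_eq_sum, plaqSU3, Complex.ofReal_div,
    ofReal_reTrSU3_eq_sum]
  push_cast
  ring

/-! ### 2. The plaquette numerator by Fourier modes -/

/-- The numerator of `⟨(1/3) Re tr U_p⟩_β` as a complex double integral. -/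
theorem ofReal_integral2_plaqSU3_numerator (β : ℝ) :
    ((∫ θ₁ in (0 : ℝ)..2 * π, ∫ θ₂ in (0 : ℝ)..2 * π,
        plaqSU3 θ₁ θ₂ * (weylSU3 θ₁ θ₂ * Real.exp (β / 3 * reTrSU3 θ₁ θ₂)) : ℝ) : ℂ)
      = ∫ θ₁ in (0 : ℝ)..2 * π, ∫ θ₂ in (0 : ℝ)..2 * π,
          (plaqSU3 θ₁ θ₂ : ℂ) * (weylSU3 θ₁ θ₂ : ℂ) * (Real.exp (β / 3 * reTrSU3 θ₁ θ₂) : ℂ) := by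
  rw [← intervalIntegral.integral_ofReal]
  refine intervalIntegral.integral_congr fun θ₁ _ => ?_
  simp only [← intervalIntegral.integral_ofReal, Complex.ofReal_mul, mul_assoc]

/-- **The numerator by Fourier modes**:
`∫∫ (1/3) Re tr U |Δ|² e^{(β/3) Re tr U} = (1/6) Σ_{v<19} Σ_{j<6} c_v (2π)² Σ_q I_{|q+a_v+d_j|} I_{|q+b_v+d'_j|} I_{|q|}`
(arguments `β/3`). -/
theorem integral2_plaqSU3_numerator_eq_sum_modes (β : ℝ) :
    (∫ θ₁ in (0 : ℝ)..2 * π, ∫ θ₂ in (0 : ℝ)..2 * π,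
        plaqSU3 θ₁ θ₂ * (weylSU3 θ₁ θ₂ * Real.exp (β / 3 * reTrSU3 θ₁ θ₂)))
      = 1 / 6 * ∑ v ∈ range 19, ∑ j : Fin 6, (su3wC v : ℝ) * ((2 * π) ^ 2 *
          ∑' q : ℤ, (besselI (q + (su3wA v + (![1, -1, 0, 0, 1, -1] : Fin 6 → ℤ) j)).natAbs (β / 3)
            * besselI (q + (su3wB v + (![0, 0, 1, -1, 1, -1] : Fin 6 → ℤ) j)).natAbs (β / 3)
            * besselI q.natAbs (β / 3))) := by
  have h1 : ((∫ θ₁ in (0 : ℝ)..2 * π, ∫ θ₂ in (0 : ℝ)..2 * π,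
        plaqSU3 θ₁ θ₂ * (weylSU3 θ₁ θ₂ * Real.exp (β / 3 * reTrSU3 θ₁ θ₂)) : ℝ) : ℂ)
      = (1 / 6 : ℂ) * ∑ v ∈ range 19, ∑ j : Fin 6, (su3wC v : ℂ) * ((2 * π : ℂ) ^ 2 *
          ∑' q : ℤ, ((besselI (q + (su3wA v + (![1, -1, 0, 0, 1, -1] : Fin 6 → ℤ) j)).natAbs (β / 3)
            * besselI (q + (su3wB v + (![0, 0, 1, -1, 1, -1] : Fin 6 → ℤ) j)).natAbs (β / 3)
            * besselI q.natAbs (β / 3) : ℝ) : ℂ)) := by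
    rw [ofReal_integral2_plaqSU3_numerator]
    have hexp : ∀ θ₁ θ₂ : ℝ,
        (plaqSU3 θ₁ θ₂ : ℂ) * (weylSU3 θ₁ θ₂ : ℂ) * (Real.exp (β / 3 * reTrSU3 θ₁ θ₂) : ℂ)
          = (1 / 6 : ℂ) * ∑ v ∈ range 19, ∑ j : Fin 6, (su3wC v : ℂ) *
              (torusMode (su3wA v + (![1, -1, 0, 0, 1, -1] : Fin 6 → ℤ) j)
                (su3wB v + (![0, 0, 1, -1, 1, -1] : Fin 6 → ℤ) j) θ₁ θ₂
                * (Real.exp (β / 3 * reTrSU3 θ₁ θ₂) : ℂ)) := by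
      intro θ₁ θ₂
      rw [plaqSU3_mul_weylSU3_eq_sum, mul_assoc, Finset.sum_mul]
      congr 1
      refine sum_congr rfl fun v _ => ?_
      rw [Finset.sum_mul]
      exact sum_congr rfl fun j _ => mul_assoc _ _ _
    simp_rw [hexp]
    rw [integral2_const_mul, integral2_finset_sum _ (fun v _ => by fun_prop)]
    congr 1
    refine sum_congr rfl fun v _ => ?_
    rw [integral2_finset_sum _ (fun j _ => by fun_prop)]
    refine sum_congr rfl fun j _ => ?_
    rw [integral2_const_mul, integral2_torusMode_mul_exp_reTrSU3]
  apply Complex.ofReal_injective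
  rw [h1]
  push_cast
  rfl

/-! ### 3. The per-charge identity for the numerator -/

/-- **The per-charge identity behind the numerator.**  Shifting the mode
`c_v e^{i((a_v+d_j)θ₁ + (b_v+d'_j)θ₂)}` — a monomial `e^{iΣ_k (σ_k − τ_k ± δ_{k,k₀}) θ_k}` of
`e^{±iθ_{k₀}} |Δ|²` — by its third exponent `n₃ = −⌊(a + b + 1)/3⌋` (`a = a_v + d_j`, `b = b_v + d'_j`;
the nearest integer to `−(a+b)/3`), the `114` products become `Π_k I_{|q + σ_k − τ_k ± δ_{k,k₀}|}`, and
reindexing `k ↦ τ⁻¹ k` turns their signed sum into `3!` times the sum over the column `l = τ(k₀)` and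
the sign of the determinants with column `l` shifted by `±1`:
`Σ_{v,j} c_v I I I = 6 Σ_{l<3} (det[I_{|q+i−j+[j=l]|}] + det[I_{|q+i−j−[j=l]|}])` (checked by `ring`). -/
theorem su3_fourier_toeplitz_identity_plaq (x : ℝ) (q : ℤ) :
    ∑ v ∈ range 19, ∑ j : Fin 6, (su3wC v : ℝ) *
        (besselI (q + -((su3wA v + (![1, -1, 0, 0, 1, -1] : Fin 6 → ℤ) j
              + (su3wB v + (![0, 0, 1, -1, 1, -1] : Fin 6 → ℤ) j) + 1) / 3)
            + (su3wA v + (![1, -1, 0, 0, 1, -1] : Fin 6 → ℤ) j)).natAbs x *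
          besselI (q + -((su3wA v + (![1, -1, 0, 0, 1, -1] : Fin 6 → ℤ) j
              + (su3wB v + (![0, 0, 1, -1, 1, -1] : Fin 6 → ℤ) j) + 1) / 3)
            + (su3wB v + (![0, 0, 1, -1, 1, -1] : Fin 6 → ℤ) j)).natAbs x *
          besselI (q + -((su3wA v + (![1, -1, 0, 0, 1, -1] : Fin 6 → ℤ) j
              + (su3wB v + (![0, 0, 1, -1, 1, -1] : Fin 6 → ℤ) j) + 1) / 3)).natAbs x)
      = 6 * ∑ l : Fin 3,
          ((Matrix.of fun i j : Fin 3 =>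
              besselI (q + (i : ℕ) - (j : ℕ) + if j = l then 1 else 0).natAbs x).det
            + (Matrix.of fun i j : Fin 3 =>
              besselI (q + (i : ℕ) - (j : ℕ) - if j = l then 1 else 0).natAbs x).det) := by
  simp +decide only [sum_range_succ, sum_range_zero, su3wA, su3wB, su3wC, Fin.sum_univ_succ,
    Fin.sum_univ_zero, Matrix.cons_val_zero, Matrix.cons_val_succ, Matrix.det_fin_three,
    Matrix.of_apply, Fin.val_zero, Fin.val_one, Fin.val_two, Nat.cast_zero, Nat.cast_one,
    Nat.cast_ofNat, Int.reduceNeg, Int.reduceAdd, Int.reduceDiv, add_zero, sub_zero, zero_add,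
    if_true, if_false]
  ring_nf

/-! ### 4. The numerator and the plaquette in Bessel–Toeplitz form -/

/-- **THE NUMERATOR IN BESSEL FORM**:
`∫_0^{2π}∫_0^{2π} (1/3) Re tr U |Δ|² e^{(β/3) Re tr U} dθ₂ dθ₁
   = (2π)² Σ_{q ∈ ℤ} Σ_{l<3} (det[I_{|q+i−j+[j=l]|}(β/3)] + det[I_{|q+i−j−[j=l]|}(β/3)])`
— the charge-`q` Toeplitz determinant with its `l`-th column shifted up and down
(`= 2 (d/dc) det[I_{q+i−j}(c)]` by `I_n' = (I_{n−1} + I_{n+1})/2`, i.e. the numerator is `dZ₃/dβ`;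
that identification is not typed here). -/
theorem integral2_plaqSU3_numerator_eq_tsum_det (β : ℝ) :
    (∫ θ₁ in (0 : ℝ)..2 * π, ∫ θ₂ in (0 : ℝ)..2 * π,
        plaqSU3 θ₁ θ₂ * (weylSU3 θ₁ θ₂ * Real.exp (β / 3 * reTrSU3 θ₁ θ₂)))
      = (2 * π) ^ 2 * ∑' q : ℤ, ∑ l : Fin 3,
          ((Matrix.of fun i j : Fin 3 =>
              besselI (q + (i : ℕ) - (j : ℕ) + if j = l then 1 else 0).natAbs (β / 3)).det
            + (Matrix.of fun i j : Fin 3 =>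
              besselI (q + (i : ℕ) - (j : ℕ) - if j = l then 1 else 0).natAbs (β / 3)).det) := by
  rw [integral2_plaqSU3_numerator_eq_sum_modes]
  -- shift the `(v, j)`-th mode sum by `k = −⌊(a + b + 1)/3⌋`
  have h3 : ∀ v ∈ range 19, ∀ j ∈ (univ : Finset (Fin 6)), (su3wC v : ℝ) * ((2 * π) ^ 2 *
      ∑' q : ℤ, (besselI (q + (su3wA v + (![1, -1, 0, 0, 1, -1] : Fin 6 → ℤ) j)).natAbs (β / 3)
        * besselI (q + (su3wB v + (![0, 0, 1, -1, 1, -1] : Fin 6 → ℤ) j)).natAbs (β / 3)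
        * besselI q.natAbs (β / 3)))
      = (2 * π) ^ 2 * ∑' q : ℤ, (su3wC v : ℝ) *
        (besselI (q + -((su3wA v + (![1, -1, 0, 0, 1, -1] : Fin 6 → ℤ) j
              + (su3wB v + (![0, 0, 1, -1, 1, -1] : Fin 6 → ℤ) j) + 1) / 3)
            + (su3wA v + (![1, -1, 0, 0, 1, -1] : Fin 6 → ℤ) j)).natAbs (β / 3) *
          besselI (q + -((su3wA v + (![1, -1, 0, 0, 1, -1] : Fin 6 → ℤ) j
              + (su3wB v + (![0, 0, 1, -1, 1, -1] : Fin 6 → ℤ) j) + 1) / 3)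
            + (su3wB v + (![0, 0, 1, -1, 1, -1] : Fin 6 → ℤ) j)).natAbs (β / 3) *
          besselI (q + -((su3wA v + (![1, -1, 0, 0, 1, -1] : Fin 6 → ℤ) j
              + (su3wB v + (![0, 0, 1, -1, 1, -1] : Fin 6 → ℤ) j) + 1) / 3)).natAbs (β / 3)) := by
    intro v _ j _
    rw [tsum_mul_left]
    conv_lhs => rw [tsum_int_shift _ (-((su3wA v + (![1, -1, 0, 0, 1, -1] : Fin 6 → ℤ) j
      + (su3wB v + (![0, 0, 1, -1, 1, -1] : Fin 6 → ℤ) j) + 1) / 3))]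
    ring
  have hsum : ∀ (v : ℕ) (j : Fin 6), Summable fun q : ℤ => (su3wC v : ℝ) *
        (besselI (q + -((su3wA v + (![1, -1, 0, 0, 1, -1] : Fin 6 → ℤ) j
              + (su3wB v + (![0, 0, 1, -1, 1, -1] : Fin 6 → ℤ) j) + 1) / 3)
            + (su3wA v + (![1, -1, 0, 0, 1, -1] : Fin 6 → ℤ) j)).natAbs (β / 3) *
          besselI (q + -((su3wA v + (![1, -1, 0, 0, 1, -1] : Fin 6 → ℤ) j
              + (su3wB v + (![0, 0, 1, -1, 1, -1] : Fin 6 → ℤ) j) + 1) / 3)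
            + (su3wB v + (![0, 0, 1, -1, 1, -1] : Fin 6 → ℤ) j)).natAbs (β / 3) *
          besselI (q + -((su3wA v + (![1, -1, 0, 0, 1, -1] : Fin 6 → ℤ) j
              + (su3wB v + (![0, 0, 1, -1, 1, -1] : Fin 6 → ℤ) j) + 1) / 3)).natAbs (β / 3)) := by
    intro v j
    simp_rw [add_assoc]
    exact (summable_besselI_triple (β / 3) _ _ _).mul_left _
  rw [sum_congr rfl fun v hv => sum_congr rfl fun j hj => h3 v hv j hj]
  simp_rw [← Finset.mul_sum]
  rw [sum_congr rfl fun v _ => (Summable.tsum_finsetSum fun j _ => hsum v j).symm,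
    ← Summable.tsum_finsetSum fun v _ => summable_sum fun j _ => hsum v j,
    tsum_congr fun q => su3_fourier_toeplitz_identity_plaq (β / 3) q, tsum_mul_left]
  ring

/-- **THE SU(3) ONE-PLAQUETTE PLAQUETTE IN BESSEL FORM.**  For every real `β`, the mean plaquette of the
SU(3) one-plaquette law (GEN-6's Weyl-torus expectation `onePlaquetteExpectSU3 β plaqSU3`, enclosed at
`β = 4, 5, 6` in `OnePlaquetteSU3Enclosures`) is the ratio of Bessel–Toeplitz series
`⟨(1/3) Re tr U_p⟩_β = Σ_{q ∈ ℤ} Σ_{l<3} (det[I_{|q+i−j+[j=l]|}] + det[I_{|q+i−j−[j=l]|}]) / (6 Σ_{q ∈ ℤ} det[I_{|q+i−j|}])`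
(all Bessel arguments `β/3`; `= (d/dβ) log Σ_q det[I_{q+i−j}(β/3)]`). -/
theorem onePlaquetteExpectSU3_plaqSU3_eq_tsum_det (β : ℝ) :
    onePlaquetteExpectSU3 β plaqSU3
      = (∑' q : ℤ, ∑ l : Fin 3,
          ((Matrix.of fun i j : Fin 3 =>
              besselI (q + (i : ℕ) - (j : ℕ) + if j = l then 1 else 0).natAbs (β / 3)).det
            + (Matrix.of fun i j : Fin 3 =>
              besselI (q + (i : ℕ) - (j : ℕ) - if j = l then 1 else 0).natAbs (β / 3)).det))
        / (6 * ∑' q : ℤ, (Matrix.of fun i j : Fin 3 =>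
            besselI (q + (i : ℕ) - (j : ℕ)).natAbs (β / 3)).det) := by
  rw [onePlaquetteExpectSU3, integral2_plaqSU3_numerator_eq_tsum_det, onePlaquetteZSU3_eq_tsum_det,
    mul_comm (6 : ℝ) ((2 * π) ^ 2), mul_assoc,
    mul_div_mul_left _ _ (by positivity : (2 * π) ^ 2 ≠ 0)]

end Summit.Ventures.LatticeQCDFlow.Scoring
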